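import Summits.ABC.IUTFork.LDHGenuineHullRegimeSlack
import Summits.ABC.IUTFork.LDHGenuineTowerArithPerImage
import HarnessLib

/-!
# The fork at [IUTchIII] Corollary 3.12, L-DH level, READING (P), TAME DATA: the crux asserts Szpiro's inequality with constant
# `12·(1 + O(1/l))` — `Cor312PerImageAtDatum P l` at a datum with no wildly ramified support place implies
# `(1/6 − 2/(l(l+1)))·log q^{∤{2,l}}(λ) ≤ (2 + 8·d_mod/l)·(log-diff + log-cond) + 5·(4 + log l) + 26 + 2·log π`
# (abc-iut cell, crux ThetaPartII = stmt-ABC-19678, registered stub `stub_cor312PerImage` (iii-P); honest-scope record)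

Record-only PROOF file (D-0012) of the abc-iut cell (WAVE-3 discharge seat abc-iut-c312-d1, gen 6); TAKES NO SIDE on [IUTchIII]
Cor. 3.12 or on the (U)/(P) readings, asserts nothing about any point. Companion of this seat's `LDHGenuinePerImageContentful`
(the PNT-free constant `B_#(P,l)` for ALL data). [IUTchIV] Thm. 1.10 proof Step (v) p. 27–29: the Step (v) term for WILDLY ramified
factors (`e_v > p − 2`: the cell's `Σ_{e_a > p−2} (3 + log e_a)` per summand, abc-iut-S2/abc-iut-c312-d1; print bounds it through
`log(𝔰^≤)` and the prime number theorem, Step (viii) p. 30) is ABSENT at a datum all of whose support places are tame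
(`e(K_{v̲}/ℚ_p) ≤ p − 2`): abc-iut-S7's `DHData.hullEstimatePerImageOf_ofInput_explicit` may then be invoked with `N := 0`,
`l* := 0` (its (R4)-shape hypothesis is vacuous), and what is left of the per-image Step (v) constant is the Step (ii)/(iii) part
`(l+1)/4·{(1+4/l)·log 𝔡^K + (4/l)·log 𝔰^ℚ}` alone, bounded by the pinned tower arithmetic (abc-iut-S1/S-d1/S3/L5-t15):

* `PointDict.hullEstimatePerImageOf_tame` — `T.HullEstimatePerImageOf ((l+1)/4·{(1+4/l)·(L + 2·log l + 21) + (4/l)·(2·d_mod·L + log(30·l))})`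
  for every TAME datum `T` at an admissible `(P, l)`, `l ≥ 7` (`L := log-diff + log 𝔣^{∤{2,l}}`);
* **`PointDict.szpiro_of_cor312PerImageAtDatum_tame`** — `Cor312PerImageAtDatum P l →` (TAME `T`)
  `((l+1)/24 − 1/(2l))·log q^{∤{2,l}}(λ) ≤ (l+1)/4·{(1+4/l)·(L + 2·log l + 21) + (4/l)·(2·d_mod·L + log(30·l))} + ((l+5)/4)·log π`;
* **`PointDict.szpiro_of_cor312PerImageAtDatum_tame_linear`** —
  `(1/6 − 2/(l(l+1)))·log q^{∤{2,l}}(λ) ≤ (2 + 8·d_mod/l)·L + 5·(4 + log l) + 26 + 2·log π`.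

READING (statement about OUR typed objects; hypothesis = the disputed crux). At TAME data the (P)-line crux `stub_cor312PerImage` is,
point by point, SZPIRO'S INEQUALITY WITH AN EXPLICIT CONSTANT: `log q^{∤{2,l}}(λ) ≤ c(l, d_mod)·(log-diff + log-cond) + O(log l)` with
`c(l, d) = (2 + 8d/l)/(1/6 − 2/(l(l+1)))` — `c(7, 1) ≈ 24.0`, `c(11, 1) ≈ 18.0`, `c(l, d) → 12` — against print's content-free display.
For orientation only (numbers, not kernel): the largest known Szpiro ratios `log|Δ_min|/log N` of elliptic curves over `ℚ` are `< 9`, so no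
known curve refutes the stub even at tame data by this route; the EXACT per-datum value of `−|log(Θ)|` (abc-iut-c312-3's content-integer
formula) sharpens `c` further but not below `≈ 12·(1 − O(1/l))`. A proof of the stub at tame data = Szpiro with constant `≈ 12–24`. Neither
direction is an in-cell target; this file only makes the arithmetic content of the disputed statement explicit. Tameness is a genuine
restriction (support primes `p ≤ [K:ℚ] + 1` may be wild); the all-data form is `LDHGenuinePerImageContentful`.
[cite: Mochizuki2012, IUTchIV Thm. 1.10 proof Steps (ii)–(viii) p. 24–30] [cite: DupuyHilado2025, §4.7, §4.11–4.12]
[claim: Mochizuki2012, status: disputed] for every IUT quotation. PROOF-ONLY: no definitions, no new `Prop`.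
-/

noncomputable section

namespace Summit.ABC.IUTFork

open Literature.IUT.HodgeTheaters Literature.IUT.LogVolume NumberField IsDedekindDomain
open Literature.NumberTheory.DiophantineGeometry.GenEll
open scoped Nat.Prime

namespace PointDict

variable {P : NFPoint} {l : ℕ}

/-- **The per-image hull estimate at a TAME datum** — reading (P), a genuine Θ-volume datum `T` at an admissible `(P, l)` (`λ ∈ U_P`
minimally presented, `l ≥ 7`) with NO wildly ramified support place (`e(K_{v̲}/ℚ_p) ≤ p − 2` at every place of the section over every
support prime): `T.HullEstimatePerImageOf ((l+1)/4·{(1+4/l)·(L + 2·log l + 21) + (4/l)·(2·d_mod·L + log(30·l))})` — abc-iut-S7's explicit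
per-image Step (v) constant at `N := 0`, `l* := 0` (the (R4) hypothesis is vacuous) with the pinned Step (ii)/(iii) tower bounds.
[cite: Mochizuki2012, IUTchIV Thm. 1.10 proof Steps (ii)–(v) p. 24–29] [claim: Mochizuki2012, status: disputed] -/
theorem hullEstimatePerImageOf_tame (T : Cor22.ThetaVolumeDatumAt P l) (hP : P ∈ UP) (h7 : 7 ≤ l)
    (htame : letI := T.instFieldF; letI := T.instNumberFieldF; letI := T.instAlgebraF; letI := T.instFieldK
      letI := T.instNumberFieldK; letI := T.instAlgebraK; letI := T.instIsElliptic
      ∀ (p : ℕ) [hp : Fact p.Prime], p ∈ T.I.supportPrimes → ∀ v : placesOver (fieldOfModuli T.E) p,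
        ¬ p - 2 < absRamificationIdx p ((T.I.σ.localFieldFamily p hp.out).k v)) :
    T.HullEstimatePerImageOf (((l : ℝ) + 1) / 4 *
      ((1 + 4 / (l : ℝ)) * (P.logDiff + Cor22.logCondAvoid P {2, l} + 2 * Real.log l + 21)
        + 4 / (l : ℝ) * (2 * (Cor22.dmod P : ℝ) * (P.logDiff + Cor22.logCondAvoid P {2, l}) + Real.log (2 * 3 * 5 * (l : ℝ))))) := by
  classical
  letI := T.instFieldF; letI := T.instNumberFieldF; letI := T.instAlgebraF; letI := T.instFieldK
  letI := T.instNumberFieldK; letI := T.instAlgebraK; letI := T.instFieldFbar; letI := T.instAlgebraFbar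
  letI := T.instAlgebraKFbar; letI := T.instIsElliptic
  have hU : P.InU := hP.1
  have hXl : ((T.I.X.l : ℕ) : ℝ) = (l : ℝ) := by exact_mod_cast T.isVolumeInputOf.l_eq
  haveI : IsGalois (fieldOfModuli T.E) T.K := T.isGalois_fieldOfModuli_K
  have hprimes : ∀ p ∈ T.I.supportPrimes, p.Prime := fun p hp => T.I.prime_of_mem_supportPrimes hp
  -- abc-iut-S7's per-image Step (v) estimate at `N := 0`, `l* := 0`: the (R4)-shape hypothesis is vacuous at a tame datum
  have h0 := DHData.hullEstimatePerImageOf_ofInput_explicit T.I 0 (le_refl (0 : ℝ))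
    (fun p hp hmem v hv => absurd hv (htame p hmem v))
  rw [hXl] at h0
  -- Step (ii): `A ≤ log 𝔡^K ≤ L + 2·log l + 21`
  have hA1 := sum_dite_localDegree_mul_differentOrd_le_ndeg (fieldOfModuli T.E) T.K T.I.σ T.I.supportPrimes hprimes
  have hA2 := T.ndeg_differentDivisor_le hU h7
  have hA : (∑ p ∈ T.I.supportPrimes, if hp : p.Prime then haveI : Fact p.Prime := ⟨hp⟩
        (∑ v : placesOver (fieldOfModuli T.E) p, (localDegree (fieldOfModuli T.E) v.1 : ℝ) *
          differentOrd p ((T.I.σ.localFieldFamily p hp).k v)) / Module.finrank ℚ (fieldOfModuli T.E) * Real.log p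
        else 0) ≤ P.logDiff + Cor22.logCondAvoid P {2, l} + 2 * Real.log l + 21 := hA1.trans hA2
  -- Step (iii): `B ≤ 2·d_mod·L + log(30·l)`
  have hB := T.sum_log_supportPrimes_le_pinned hP
  refine hullEstimatePerImageOf_mono T h0 ?_
  have hc0 : (0 : ℝ) ≤ ((l : ℝ) + 1) / 4 := by positivity
  have hl0 : (0 : ℝ) < l := by exact_mod_cast (lt_of_lt_of_le (by norm_num) h7)
  have hc1 : (0 : ℝ) ≤ 1 + 4 / (l : ℝ) := by positivity
  have hc2 : (0 : ℝ) ≤ 4 / (l : ℝ) := by positivity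
  refine mul_le_mul_of_nonneg_left ?_ hc0
  have t1 := mul_le_mul_of_nonneg_left hA hc1
  have t2 := mul_le_mul_of_nonneg_left hB hc2
  have e : (20 : ℝ) / 3 * 0 * (((T.I.supportPrimes.filter (· ≤ 0)).card : ℕ) : ℝ) = 0 := by ring
  linarith

/-- **TAME DATA: `Cor312PerImageAtDatum P l` ⟹ Szpiro-type inequality with the Step (ii)/(iii) constant only.**
[cite: Mochizuki2012, IUTchIV Thm. 1.10 proof Steps (v)–(x) p. 27–32] [claim: Mochizuki2012, status: disputed] -/
theorem szpiro_of_cor312PerImageAtDatum_tame (hP : P ∈ UP) (h7 : 7 ≤ l) (h : Cor22.Cor312PerImageAtDatum P l)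
    (T : Cor22.ThetaVolumeDatumAt P l)
    (htame : letI := T.instFieldF; letI := T.instNumberFieldF; letI := T.instAlgebraF; letI := T.instFieldK
      letI := T.instNumberFieldK; letI := T.instAlgebraK; letI := T.instIsElliptic
      ∀ (p : ℕ) [hp : Fact p.Prime], p ∈ T.I.supportPrimes → ∀ v : placesOver (fieldOfModuli T.E) p,
        ¬ p - 2 < absRamificationIdx p ((T.I.σ.localFieldFamily p hp.out).k v)) :
    (((l : ℝ) + 1) / 24 - 1 / (2 * l)) * Cor22.logQAvoid P {2, l} ≤
      ((l : ℝ) + 1) / 4 *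
        ((1 + 4 / (l : ℝ)) * (P.logDiff + Cor22.logCondAvoid P {2, l} + 2 * Real.log l + 21)
          + 4 / (l : ℝ) * (2 * (Cor22.dmod P : ℝ) * (P.logDiff + Cor22.logCondAvoid P {2, l}) + Real.log (2 * 3 * 5 * (l : ℝ))))
      + ThetaVolumeInput.archLogTheta l := by
  rw [← gap_eq T hP.1]
  exact T.gap_le_perImage (h T) (hullEstimatePerImageOf_tame T hP h7 htame)

/-- **TAME DATA, LINEAR FORM: the (P)-line crux is Szpiro's inequality with constant `c(l, d_mod) = (2 + 8·d_mod/l)/(1/6 − 2/(l(l+1)))`**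
(`c(7,1) ≈ 24`, `c(l,d) → 12`): `(1/6 − 2/(l(l+1)))·log q^{∤{2,l}}(λ) ≤ (2 + 8·d_mod/l)·L + 5·(4 + log l) + 26 + 2·log π`.
[cite: Mochizuki2012, IUTchIV Thm. 1.10 proof Steps (v)–(x) p. 27–32] [claim: Mochizuki2012, status: disputed] -/
theorem szpiro_of_cor312PerImageAtDatum_tame_linear (hP : P ∈ UP) (h7 : 7 ≤ l) (h : Cor22.Cor312PerImageAtDatum P l)
    (T : Cor22.ThetaVolumeDatumAt P l)
    (htame : letI := T.instFieldF; letI := T.instNumberFieldF; letI := T.instAlgebraF; letI := T.instFieldK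
      letI := T.instNumberFieldK; letI := T.instAlgebraK; letI := T.instIsElliptic
      ∀ (p : ℕ) [hp : Fact p.Prime], p ∈ T.I.supportPrimes → ∀ v : placesOver (fieldOfModuli T.E) p,
        ¬ p - 2 < absRamificationIdx p ((T.I.σ.localFieldFamily p hp.out).k v)) :
    (1 / 6 - 2 / ((l : ℝ) * ((l : ℝ) + 1))) * Cor22.logQAvoid P {2, l} ≤
      (2 + 8 * (Cor22.dmod P : ℝ) / l) * (P.logDiff + Cor22.logCondAvoid P {2, l})
        + 5 * (4 + Real.log l) + 26 + 2 * Real.log Real.pi := by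
  have hmain := szpiro_of_cor312PerImageAtDatum_tame hP h7 h T htame
  have hl7 : (7 : ℝ) ≤ l := by exact_mod_cast h7
  have hl0 : (0 : ℝ) < l := by linarith
  have harch : ThetaVolumeInput.archLogTheta l = ((l : ℝ) + 5) / 4 * Real.log Real.pi := rfl
  rw [harch] at hmain
  set L : ℝ := P.logDiff + Cor22.logCondAvoid P {2, l} with hLdef
  set D : ℝ := (Cor22.dmod P : ℝ) with hDdef
  set X : ℝ := Real.log (2 * 3 * 5 * (l : ℝ)) with hXdef
  have hL0 : 0 ≤ L := add_nonneg P.logDiff_nonneg (Cor22.logCondAvoid_nonneg P _)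
  have hD0 : 0 ≤ D := by rw [hDdef]; positivity
  have hlogl : 0 ≤ Real.log l := Real.log_nonneg (by linarith)
  have hpi0 : 0 ≤ Real.log Real.pi := Real.log_nonneg (by linarith [Real.pi_gt_three])
  -- `log(30·l) ≤ 4 + log l`
  have hX0 : 0 ≤ X := Real.log_nonneg (by linarith)
  have hX : X ≤ 4 + Real.log l := by
    have h32 : Real.log (2 * 3 * 5 * (l : ℝ)) ≤ Real.log ((2 : ℝ) ^ 5 * (l : ℝ)) :=
      Real.log_le_log (by positivity) (by nlinarith)
    have e : Real.log ((2 : ℝ) ^ 5 * (l : ℝ)) = 5 * Real.log 2 + Real.log l := by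
      rw [Real.log_mul (by norm_num) hl0.ne', Real.log_pow]; push_cast; ring
    rw [e] at h32
    have h2 := Real.log_two_lt_d9
    rw [hXdef]
    linarith
  -- (a) and (b) as in the all-data file
  have h4l : 4 / (l : ℝ) ≤ 1 := by rw [div_le_one hl0]; linarith
  have ha : (1 + 4 / (l : ℝ)) * (L + 2 * Real.log l + 21) ≤ 2 * (L + 2 * Real.log l + 21) :=
    mul_le_mul_of_nonneg_right (by linarith) (by positivity)
  have hb : 4 / (l : ℝ) * (2 * D * L + X) ≤ 8 * D / l * L + (4 + Real.log l) := by
    have t : 4 / (l : ℝ) * X ≤ 1 * X := mul_le_mul_of_nonneg_right h4l hX0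
    have e : 4 / (l : ℝ) * (2 * D * L + X) = 8 * D / l * L + 4 / (l : ℝ) * X := by ring
    rw [e]; linarith
  have hbr : (1 + 4 / (l : ℝ)) * (L + 2 * Real.log l + 21) + 4 / (l : ℝ) * (2 * D * L + X) ≤
      (2 + 8 * D / l) * L + 5 * (4 + Real.log l) + 26 := by
    have e : (2 + 8 * D / l) * L = 2 * L + 8 * D / l * L := by ring
    linarith
  have hc0 : (0 : ℝ) < ((l : ℝ) + 1) / 4 := by positivity
  have hdarch : ((l : ℝ) + 5) / 4 * Real.log Real.pi ≤ ((l : ℝ) + 1) / 4 * (2 * Real.log Real.pi) := by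
    have : ((l : ℝ) + 5) / 4 ≤ ((l : ℝ) + 1) / 4 * 2 := by linarith
    calc ((l : ℝ) + 5) / 4 * Real.log Real.pi ≤ ((l : ℝ) + 1) / 4 * 2 * Real.log Real.pi :=
        mul_le_mul_of_nonneg_right this hpi0
      _ = ((l : ℝ) + 1) / 4 * (2 * Real.log Real.pi) := by ring
  have hleft : ((l : ℝ) + 1) / 4 * ((1 / 6 - 2 / ((l : ℝ) * ((l : ℝ) + 1))) * Cor22.logQAvoid P {2, l}) ≤
      (((l : ℝ) + 1) / 24 - 1 / (2 * l)) * Cor22.logQAvoid P {2, l} := by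
    have hl1' : (0 : ℝ) < (l : ℝ) + 1 := by linarith
    have e : ((l : ℝ) + 1) / 4 * (1 / 6 - 2 / ((l : ℝ) * ((l : ℝ) + 1))) = ((l : ℝ) + 1) / 24 - 1 / (2 * l) := by
      field_simp
      ring
    rw [← mul_assoc, e]
  have hR := mul_le_mul_of_nonneg_left hbr hc0.le
  have htot : ((l : ℝ) + 1) / 4 * ((1 / 6 - 2 / ((l : ℝ) * ((l : ℝ) + 1))) * Cor22.logQAvoid P {2, l}) ≤
      ((l : ℝ) + 1) / 4 * ((2 + 8 * D / l) * L + 5 * (4 + Real.log l) + 26 + 2 * Real.log Real.pi) := by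
    have e : ((l : ℝ) + 1) / 4 * ((2 + 8 * D / l) * L + 5 * (4 + Real.log l) + 26 + 2 * Real.log Real.pi)
        = ((l : ℝ) + 1) / 4 * ((2 + 8 * D / l) * L + 5 * (4 + Real.log l) + 26)
          + ((l : ℝ) + 1) / 4 * (2 * Real.log Real.pi) := by ring
    rw [e]
    linarith [hleft, hmain, hR, hdarch]
  exact le_of_mul_le_mul_left htot hc0

end PointDict

end Summit.ABC.IUTFork

end
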